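import Mathlib
import Summits.ValiantsHypothesis.ValiantsHypothesis.Theorems.SymmetroidPencilBasics

/-!
# Stub `stub_negRoots` for crux `MatrixDescartes`, line `Lift`

Let `F(X) = ∑ₗ X^{dₗ} Sₗ` be a lacunary pencil of real `m × m` matrices and `p = det F ∈ ℝ[X]`.
The transfer along the line `Lift` only bounds POSITIVE roots, so the line needs the elementary
count
`#(distinct real roots of p) ≤ #(positive roots of p) + #(positive roots of p⁻) + 1`,
where `p⁻ = det (∑ₗ X^{dₗ} ((-1)^{dₗ} Sₗ))` is the determinant of the reflected pencil `F(-X)`.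

Route.  Evaluation commutes with `det` (the landed tree lemma
`…Theorems.SymmetroidDescartes.eval_det_pencil`, imported), so `p.eval (-t) = p⁻.eval t` for
every real `t` (`(-t)^d = (-1)^d t^d`).  Hence `p ≠ 0 → p⁻ ≠ 0` (a real polynomial vanishing
everywhere is zero), and `t ↦ -t` injects the negative roots of `p` into the positive roots of
`p⁻`.  Finally the root set of `p` splits as `{t > 0} ∪ {t < 0} ∪ (⊆ {0})`.  If `p = 0` the
claim is trivial since `roots 0 = 0`.
-/

-- `Summit.ValiantsHypothesis.ValiantsHypothesis.…` is the tree's mandated single-conjunct layout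
-- (Sub = Summit), so the duplicated namespace component is intended.
set_option linter.dupNamespace false

namespace Summit.ValiantsHypothesis.ValiantsHypothesis.Theorems.LacunarySymmetroidMatrixDescartes

open Polynomial Matrix Finset
open scoped BigOperators

open Summit.ValiantsHypothesis.ValiantsHypothesis.Theorems.SymmetroidDescartes (eval_det_pencil)

namespace NegRoots

/-- Reflection `X ↦ -X` at the level of evaluations: the pencil determinant
`p = det (∑ X^(d l) • S l)` and the reflected pencil determinant
`p⁻ = det (∑ X^(d l) • ((-1)^(d l) • S l))` satisfy `p.eval (-t) = p⁻.eval t`. [folklore] -/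
theorem eval_neg_det_pencil {ι : Type*} [Fintype ι] {m : ℕ}
    (S : ι → Matrix (Fin m) (Fin m) ℝ) (d : ι → ℕ) (t : ℝ) :
    ((∑ l, (Polynomial.X : ℝ[X]) ^ d l • (S l).map Polynomial.C).det).eval (-t)
      = ((∑ l, (Polynomial.X : ℝ[X]) ^ d l •
          (((-1 : ℝ) ^ d l) • S l).map Polynomial.C).det).eval t := by
  rw [eval_det_pencil, eval_det_pencil]
  congr 1
  refine Finset.sum_congr rfl fun l _ => ?_
  rw [smul_smul, neg_pow, mul_comm]

/-- If the pencil determinant `p` is nonzero then so is the reflected pencil determinant `p⁻`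
(otherwise `p` would vanish at every real point). [folklore] -/
theorem det_pencil_reflect_ne_zero {ι : Type*} [Fintype ι] {m : ℕ}
    (S : ι → Matrix (Fin m) (Fin m) ℝ) (d : ι → ℕ)
    (hp : (∑ l, (Polynomial.X : ℝ[X]) ^ d l • (S l).map Polynomial.C).det ≠ 0) :
    (∑ l, (Polynomial.X : ℝ[X]) ^ d l • (((-1 : ℝ) ^ d l) • S l).map Polynomial.C).det ≠ 0 := by
  intro hq
  apply hp
  refine Polynomial.funext fun t => ?_
  have h := eval_neg_det_pencil S d (-t)
  rw [neg_neg, hq, Polynomial.eval_zero] at h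
  rw [h, Polynomial.eval_zero]

/-- The negative roots of the pencil determinant `p` inject (via `t ↦ -t`) into the positive roots
of the reflected pencil determinant `p⁻`. [folklore] -/
theorem card_negRoots_le_card_posRoots_reflect {ι : Type*} [Fintype ι] {m : ℕ}
    (S : ι → Matrix (Fin m) (Fin m) ℝ) (d : ι → ℕ)
    (hp : (∑ l, (Polynomial.X : ℝ[X]) ^ d l • (S l).map Polynomial.C).det ≠ 0) :
    ((∑ l, (Polynomial.X : ℝ[X]) ^ d l • (S l).map Polynomial.C).det.roots.toFinset.filter
        (fun t => t < 0)).card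
      ≤ ((∑ l, (Polynomial.X : ℝ[X]) ^ d l •
          (((-1 : ℝ) ^ d l) • S l).map Polynomial.C).det.roots.toFinset.filter
            (fun t => 0 < t)).card := by
  have hq := det_pencil_reflect_ne_zero S d hp
  refine Finset.card_le_card_of_injOn (fun t => -t) (fun t ht => ?_)
    (fun a _ b _ h => neg_injective h)
  simp only [Finset.coe_filter, Set.mem_setOf_eq, Multiset.mem_toFinset,
    Polynomial.mem_roots hp, Polynomial.mem_roots hq] at ht ⊢
  refine ⟨?_, neg_pos.mpr ht.2⟩
  rw [Polynomial.IsRoot.def, ← eval_neg_det_pencil, neg_neg]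
  exact ht.1

/-- A finset of reals has at most `#(positive elements) + #(negative elements) + 1` elements.
[folklore] -/
theorem card_le_card_pos_add_card_neg_add_one (s : Finset ℝ) :
    s.card ≤ (s.filter (fun t => 0 < t)).card + (s.filter (fun t => t < 0)).card + 1 := by
  have hsplit : s ⊆ s.filter (fun t => 0 < t) ∪ s.filter (fun t => t < 0) ∪ {0} := by
    intro t ht
    rcases lt_trichotomy t 0 with h | h | h
    · exact Finset.mem_union_left _ (Finset.mem_union_right _ (Finset.mem_filter.2 ⟨ht, h⟩))
    · subst h
      exact Finset.mem_union_right _ (Finset.mem_singleton_self _)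
    · exact Finset.mem_union_left _ (Finset.mem_union_left _ (Finset.mem_filter.2 ⟨ht, h⟩))
  calc s.card
      ≤ (s.filter (fun t => 0 < t) ∪ s.filter (fun t => t < 0) ∪ {0}).card :=
        Finset.card_le_card hsplit
    _ ≤ (s.filter (fun t => 0 < t) ∪ s.filter (fun t => t < 0)).card + ({0} : Finset ℝ).card :=
        Finset.card_union_le _ _
    _ ≤ (s.filter (fun t => 0 < t)).card + (s.filter (fun t => t < 0)).card + 1 := by
        rw [Finset.card_singleton]
        exact Nat.add_le_add_right (Finset.card_union_le _ _) 1

end NegRoots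

open NegRoots in
/-- **Stub `stub_negRoots`** (line `Lift`).  For the lacunary pencil `F(X) = ∑ₗ X^{dₗ} Sₗ` with
determinant `p = det F` and reflected determinant `p⁻ = det (∑ₗ X^{dₗ} ((-1)^{dₗ} Sₗ))`:
`#(distinct real roots of p) ≤ #(positive roots of p) + #(positive roots of p⁻) + 1`
(the real roots split by sign, `0` contributes at most one, and `t ↦ -t` injects the negative
roots of `p` into the positive roots of `p⁻`). [folklore] -/
theorem stub_negRoots (K m : ℕ) (d : Fin K → ℕ) (S : Fin K → Matrix (Fin m) (Fin m) ℝ) :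
    (Matrix.det (∑ l, ((Polynomial.X : Polynomial ℝ) ^ d l) • (S l).map Polynomial.C)).roots.toFinset.card
      ≤ ((Matrix.det (∑ l, ((Polynomial.X : Polynomial ℝ) ^ d l) • (S l).map Polynomial.C)).roots.toFinset.filter
            (fun t => 0 < t)).card
        + ((Matrix.det (∑ l, ((Polynomial.X : Polynomial ℝ) ^ d l) •
              (((-1 : ℝ) ^ d l) • S l).map Polynomial.C)).roots.toFinset.filter (fun t => 0 < t)).card
        + 1 := by
  by_cases hp :
      (Matrix.det (∑ l, ((Polynomial.X : Polynomial ℝ) ^ d l) • (S l).map Polynomial.C)) = 0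
  · rw [hp]
    simp
  calc (Matrix.det (∑ l, ((Polynomial.X : Polynomial ℝ) ^ d l) •
          (S l).map Polynomial.C)).roots.toFinset.card
      ≤ ((Matrix.det (∑ l, ((Polynomial.X : Polynomial ℝ) ^ d l) •
            (S l).map Polynomial.C)).roots.toFinset.filter (fun t => 0 < t)).card
        + ((Matrix.det (∑ l, ((Polynomial.X : Polynomial ℝ) ^ d l) •
            (S l).map Polynomial.C)).roots.toFinset.filter (fun t => t < 0)).card + 1 :=
        card_le_card_pos_add_card_neg_add_one _
    _ ≤ _ := Nat.add_le_add_right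
        (Nat.add_le_add_left (card_negRoots_le_card_posRoots_reflect S d hp) _) 1

end Summit.ValiantsHypothesis.ValiantsHypothesis.Theorems.LacunarySymmetroidMatrixDescartes
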